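import Literature.NumberTheory.EllipticCurves.KubertTateThirteen
import HarnessLib

/-!
# The raw plane model of the modular curve `X₁(14)` in Tate normal form, and its birational map
# to the elliptic curve `14A4`

Topic `NumberTheory/EllipticCurves`; continues `Literature.NumberTheory.EllipticCurves.KubertTateThirteen`
(the Tate normal form `E(b, c) : y² + (1 - c)xy - by = x³ - bx²` with marked point `P = (0, 0)`,
Sutherland's chart `b = rs(r - 1)`, `c = s(r - 1)`, and the multiples `2P, …, 6P`, `x(7P)`,
Knapp §V.5, Sutherland 2012 §2). Everything here is PROVED; nothing is a named fact.

Following Sutherland (2012, §2 "Computing the raw form of `X₁(N)`", and Table "`F_N(r,s)`",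
entry `N = 14`): `14P = 𝒪 ⟺ x(8P) = x(6P)`, and clearing denominators in `x₈ = x₆` and discarding
the factors supported on the degenerate locus (`r`, `r - 1`, `s`, `s - 1`, the `7`-torsion
factor `r - s` and the `8`-torsion factor `rs - 2r + 1`) leaves

  `F₁₄(r, s) = r²s³ - 5r²s² + 6r²s - r² + rs⁴ - 3rs³ + 6rs² - 7rs + r + s`,

a plane curve of genus `1`. Sutherland's Table "birational maps" gives `X₁(14)` the optimized
model `f₁₄ : y² + (x² + x)y + x = 0` with `r = 1 - (x + y)/((y + 1)(x + y + 1))`,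
`s = (1 - x)/(y + 1)`, and the short Weierstrass model `y² = x³ - 675x + 13662`, which is the
curve `14A4 : η² + ξη + η = ξ³ - ξ` of Cremona's table (`c₄ = 25`, `c₆ = -253`). This file carries
this out inside Lean, over an arbitrary field `F`:

* `kubertTate_seven_nsmul_zero'`, `kubertTate_eight_nsmul_zero` — on `E(rs(r-1), s(r-1))`:
  `7P = (rs(r-1)(s-1)(rs-2r+1)/(r-s)², r²s(r-1)²(s-1)²(r-s²+s-1)/(r-s)³)` and
  `x(8P) = x(6P) - (r-1)(r-s)·F₁₄(r,s)/((s-1)²(rs-2r+1)²)` (chord steps `6P + P`, `7P + P`);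
* `kubertTate_fourteen_nsmul_zero_iff` — for `r ∉ {0, 1}`, `s ∉ {0, 1}`, `r ≠ s`,
  `rs - 2r + 1 ≠ 0`: `14P = 𝒪 ⟺ F₁₄(r, s) = 0`, and the exact-order form
  `kubertTate_addOrderOf_zero_eq_fourteen_iff_raw` under the same non-degeneracy hypotheses;
* **`exists_kubertTateRaw₁₄_eq_zero_of_addOrderOf_eq_fourteen`** — for all `b c : F` with
  `(0, 0)` nonsingular of order `14` on `E(b, c)`: `b = rs(r-1)`, `c = s(r-1)` with
  `F₁₄(r, s) = 0` and `r ∉ {0,1}`, `s ∉ {0,1}`, `r ≠ s`, `rs - 2r + 1 ≠ 0` (all the non-degeneracy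
  is DERIVED from `addOrderOf P = 14` via equal `x`-coordinates, Mathlib's `X_eq_iff`);
* the inverse of Sutherland's birational map, written out: `y + 1 = (r - s)/((1 - r)(1 - s))`,
  `x = 1 - s(y + 1)` carries `F₁₄ = 0` to `f₁₄ = 0` (`sutherlandModel_of_kubertTateRaw₁₄`), then
  `(ξ, η) = (-y, y(x + 1))` to `14A4` and `(u, v) = (4ξ + 4, 8η + 4ξ + 4)` to the `2`-torsion normal
  form `V : v² = u³ - 11u² + 32u` used by `X1FourteenMordellWeil.lean`; in closed form
  `u = 4(2rs - 3r - s + 2)/((r-1)(s-1))`, `v = 4(-2rs³ + 5rs² + 3r²s - s² - 6rs - 5r² + s + 7r - 2)/((r-1)²(s-1)²)`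
  with the polynomial identity `Vₙ² - (Uₙ³ - 11Uₙ²D + 32UₙD²)D = -64(r-s)(rs-2r+1)F₁₄`
  (`X1Fourteen_equation_of_kubertTateRaw₁₄`), and `u ≠ 4` (`⟸ rs - 2r + 1 ≠ 0`), `u ≠ 8` (`⟸ r ≠ s`),
  `u ≠ 0` when `2 ≠ 0` (`(2r-1)⁴F₁₄ = 2(r-1)⁶ + H·(2rs-3r-s+2)` for an explicit `H ∈ ℤ[r,s]`);
* **`exists_X1Fourteen_point_of_addOrderOf_eq_fourteen`** — over any field with `2 ≠ 0`: a
  nonsingular point of order `14` on any Weierstrass cubic yields `u v` with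
  `v² = u³ - 11u² + 32u` and `u ∉ {0, 4, 8}`; contrapositive
  `not_exists_addOrderOf_eq_fourteen_of_X1Fourteen_points`.

The determination `V(ℚ) = {u ∈ {0, 4, 8}}` (rank `0`, six cusps) is the sibling file
`X1FourteenMordellWeil.lean`; the conclusion over `ℚ` ("no rational point of order `14`", the case
`m = 14` of Mazur's Thm. (7'), Kubert 1976 Ch. IV) is drawn in the proofs file that imports both.
The polynomial identities were derived by machine (exact polynomial arithmetic) and are certified
here by `ring`/`field_simp`/`linear_combination`.

## References

* [Sutherland2012] A. V. Sutherland, *Constructing elliptic curves over finite fields with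
  prescribed torsion*, Math. Comp. 81 (2012) 1131–1147: §2 (raw form, `NP = 0 ⟺ x_m = x_n`,
  `x_{n+1} = by_n/x_n²`), Table "`F_N(r, s)`" entry `N = 14`, Table "`f_N(x, y)`" entry
  `N = 14: y² + (x² + x)y + x`, Table "birational maps" entry `N = 14`, Table "genus 1 cases"
  entry `N = 14: y² = x³ - 675x + 13662`.
* [Knapp1993] A. W. Knapp, *Elliptic Curves*, §V.5 pp. 146–147 (Tate normal form).
* [Kubert1976] D. S. Kubert, *Universal bounds on the torsion of elliptic curves*, Proc. London
  Math. Soc. (3) 33 (1976) 193–237, Ch. IV.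
* [CremonaAlgorithms1997] J. E. Cremona, *Algorithms for Modular Elliptic Curves*, Table 1,
  `14A4 = [1, 0, 1, -1, 0]`.

## Design choices

As in `KubertTateThirteen.lean`: dot-notation-style extension of Mathlib's `WeierstrassCurve`
namespace, general field with `[DecidableEq F]`, multiples stated as `∃ h, k • P = .some xₖ yₖ h`,
and the `(r, s)`-polynomial `kubertTateRaw₁₄` written out in full. No `(b, c)`-form polynomial is
introduced (it is not needed by the consumers); the entry point from `(b, c)` is the theorem
`exists_kubertTateRaw₁₄_eq_zero_of_addOrderOf_eq_fourteen`.
-/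

noncomputable section

namespace WeierstrassCurve

/-! ### The plane equation and the polynomial identities -/

section Ring

variable {R : Type*} [CommRing R]

/-- **The raw form of `X₁(14)`** in Sutherland's coordinates `(r, s)` (`b = rs(r-1)`, `c = s(r-1)`):
`F₁₄(r, s) := r²s³ - 5r²s² + 6r²s - r² + rs⁴ - 3rs³ + 6rs² - 7rs + r + s`, the numerator of
`x(8P) - x(6P)` on `E(rs(r-1), s(r-1))` stripped of the degenerate factors `r - 1`, `r - s`,
`(s - 1)²`, `(rs - 2r + 1)²` (`kubertTate_eight_nsmul_zero`). [cite: Sutherland2012, §2 Table "F_N(r,s)", N = 14] -/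
def kubertTateRaw₁₄ (r s : R) : R :=
  r ^ 2 * s ^ 3 - 5 * r ^ 2 * s ^ 2 + 6 * r ^ 2 * s - r ^ 2 + r * s ^ 4 - 3 * r * s ^ 3
    + 6 * r * s ^ 2 - 7 * r * s + r + s

/-- `F₁₄(r, 1) = (r - 1)²` (the `6`-torsion line `s = 1` meets `F₁₄ = 0` only at `r = 1`). [folklore] -/
theorem kubertTateRaw₁₄_self_one (r : R) : kubertTateRaw₁₄ r 1 = (r - 1) ^ 2 := by
  simp only [kubertTateRaw₁₄]
  ring

/-- `F₁₄(r, r) = 2r(r - 1)⁴` (the `7`-torsion line `r = s`). [folklore] -/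
theorem kubertTateRaw₁₄_self_self (r : R) : kubertTateRaw₁₄ r r = 2 * r * (r - 1) ^ 4 := by
  simp only [kubertTateRaw₁₄]
  ring

/-- `F₁₄(r, 0) = -r(r - 1)`. [folklore] -/
theorem kubertTateRaw₁₄_right_zero (r : R) : kubertTateRaw₁₄ r 0 = -(r * (r - 1)) := by
  simp only [kubertTateRaw₁₄]
  ring

/-- `F₁₄(0, s) = s`. [folklore] -/
theorem kubertTateRaw₁₄_zero_left (s : R) : kubertTateRaw₁₄ 0 s = s := by
  simp only [kubertTateRaw₁₄]
  ring

/-- `F₁₄(1, s) = s²(s - 1)²`. [folklore] -/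
theorem kubertTateRaw₁₄_one_left (s : R) : kubertTateRaw₁₄ 1 s = s ^ 2 * (s - 1) ^ 2 := by
  simp only [kubertTateRaw₁₄]
  ring

/-- **Elimination of `s` between `F₁₄ = 0` and `2rs - 3r - s + 2 = 0`**: the identity
`(2r - 1)⁴ · F₁₄(r, s) = 2(r - 1)⁶ + H(r, s) · (2rs - 3r - s + 2)` with the explicit integer
polynomial `H` below (pseudo-division by the linear-in-`s` factor). It is used to show that the
line `2rs - 3r - s + 2 = 0` (the fibre of the birational map over the `2`-torsion point
`ξ = -1` of `14A4`) meets `X₁(14)` only in the degenerate point `r = 1`, in characteristic `≠ 2`.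
[folklore] -/
theorem two_mul_sub_one_pow_four_mul_kubertTateRaw₁₄ (r s : R) :
    (2 * r - 1) ^ 4 * kubertTateRaw₁₄ r s = 2 * (r - 1) ^ 6 +
      (8 * r ^ 4 * s ^ 3 + 8 * r ^ 5 * s ^ 2 - 12 * r ^ 3 * s ^ 3 - 24 * r ^ 4 * s ^ 2
        - 28 * r ^ 5 * s + 6 * r ^ 2 * s ^ 3 + 22 * r ^ 3 * s ^ 2 + 70 * r ^ 4 * s + 6 * r ^ 5
        - r * s ^ 3 - 8 * r ^ 2 * s ^ 2 - 64 * r ^ 3 * s - 16 * r ^ 4 + r * s ^ 2 + 26 * r ^ 2 * s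
        + 18 * r ^ 3 - 4 * r * s - 12 * r ^ 2 + 5 * r - 1) * (2 * r * s - 3 * r - s + 2) := by
  simp only [kubertTateRaw₁₄]
  ring

/-- **The polynomial identity behind the map `X₁(14) → V : v² = u³ - 11u² + 32u`.** With
`D = (r - 1)(s - 1)`, `U = 4(2rs - 3r - s + 2)` and
`Vₙ = 4(-2rs³ + 5rs² + 3r²s - s² - 6rs - 5r² + s + 7r - 2)` (so that `u = U/D`, `v = Vₙ/D²`):
`Vₙ² - (U³ - 11U²D + 32UD²)·D = -64(r - s)(rs - 2r + 1)·F₁₄(r, s)`. [folklore] -/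
theorem X1Fourteen_polynomial_identity (r s : R) :
    (4 * (-2 * r * s ^ 3 + 5 * r * s ^ 2 + 3 * r ^ 2 * s - s ^ 2 - 6 * r * s - 5 * r ^ 2 + s
        + 7 * r - 2)) ^ 2
      - ((4 * (2 * r * s - 3 * r - s + 2)) ^ 3
          - 11 * (4 * (2 * r * s - 3 * r - s + 2)) ^ 2 * ((r - 1) * (s - 1))
          + 32 * (4 * (2 * r * s - 3 * r - s + 2)) * ((r - 1) * (s - 1)) ^ 2) * ((r - 1) * (s - 1))
      = -64 * (r - s) * (r * s - 2 * r + 1) * kubertTateRaw₁₄ r s := by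
  simp only [kubertTateRaw₁₄]
  ring

end Ring

/-! ### Multiples of the marked point in the coordinates `(r, s)`: `7P` and `x(8P)` -/

section Field

variable {F : Type*} [Field F] [DecidableEq F]

omit [DecidableEq F] in
/-- Transport of an affine point along equalities of its coordinates (the nonsingularity witness
is proof-irrelevant). [folklore] -/
private theorem some_eq_some_of_coord_eq {W : WeierstrassCurve F} {x y x' y' : F}
    (h : W.toAffine.Nonsingular x y) (hx : x = x') (hy : y = y') :
    ∃ h', (Affine.Point.some x y h : W.toAffine.Point) = Affine.Point.some x' y' h' := by
  subst hx hy
  exact ⟨h, rfl⟩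

omit [DecidableEq F] in
/-- In an additive group, `(k+1)·P = ±P` forces `k·P = 0` or `(k+2)·P = 0`. [folklore] -/
private theorem nsmul_eq_zero_or_of_eq_or_eq_neg {A : Type*} [AddGroup A] (P : A) (k : ℕ)
    (h : (k + 1) • P = P ∨ (k + 1) • P = -P) : k • P = 0 ∨ (k + 2) • P = 0 := by
  rcases h with h | h
  · left
    rwa [succ_nsmul, add_eq_right] at h
  · right
    rw [succ_nsmul] at h
    rw [show k + 2 = k + 1 + 1 from rfl, succ_nsmul, succ_nsmul, h, neg_add_cancel]

variable (r s : F)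

/-- **`7P = (rs(r-1)(s-1)(rs-2r+1)/(r-s)², r²s(r-1)²(s-1)²(r-s²+s-1)/(r-s)³)`** on
`E(rs(r-1), s(r-1))`, for `s ≠ 1`, `r ≠ s` (`7P = 6P + P`, chord slope
`s(r-1)(rs-2r+1)/((s-1)(r-s))`); both coordinates, refining the tree's
`kubertTate_seven_nsmul_zero` (which records `x(7P)` as `x(6P)` minus the `F₁₃`-correction). The
abscissa vanishes exactly on the `8`-torsion curve `rs - 2r + 1 = 0`, the ordinate on the
`9`-torsion curve `r - s² + s - 1 = 0`. [cite: Sutherland2012, §2 (table of xₙ: x₇; raw forms F₈ = rs−2r+1, F₉ = r−s²+s−1)] -/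
theorem kubertTate_seven_nsmul_zero'
    (h₀ : (kubertTate (r * s * (r - 1)) (s * (r - 1))).toAffine.Nonsingular 0 0)
    (hr : r ≠ 0) (hr₁ : r ≠ 1) (hs : s ≠ 0) (hs₁ : s ≠ 1) (hrs : r ≠ s) :
    ∃ h, 7 • (Affine.Point.some 0 0 h₀ : (kubertTate (r * s * (r - 1)) (s * (r - 1))).toAffine.Point)
      = Affine.Point.some (r * s * (r - 1) * (s - 1) * (r * s - 2 * r + 1) / (r - s) ^ 2)
          (r ^ 2 * s * (r - 1) ^ 2 * (s - 1) ^ 2 * (r - s ^ 2 + s - 1) / (r - s) ^ 3) h := by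
  obtain ⟨h₆, e₆⟩ := kubertTate_six_nsmul_zero r s h₀ hr hr₁ hs hs₁
  have hs₁' : s - 1 ≠ 0 := sub_ne_zero.mpr hs₁
  have hr₁' : r - 1 ≠ 0 := sub_ne_zero.mpr hr₁
  have hrs' : r - s ≠ 0 := sub_ne_zero.mpr hrs
  have hx : s * (r - 1) * (r - s) / (s - 1) ^ 2 ≠ 0 :=
    div_ne_zero (mul_ne_zero (mul_ne_zero hs hr₁') hrs') (pow_ne_zero 2 hs₁')
  rw [show (7 : ℕ) = 6 + 1 from rfl, succ_nsmul, e₆]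
  obtain ⟨h₇, e⟩ := kubertTate_some_add_some_zero (r * s * (r - 1)) (s * (r - 1)) h₆ h₀ hx
  rw [e]
  have hL : s ^ 2 * (r - 1) ^ 2 * (r * s - 2 * r + 1) / (s - 1) ^ 3
      / (s * (r - 1) * (r - s) / (s - 1) ^ 2)
      = s * (r - 1) * (r * s - 2 * r + 1) / ((s - 1) * (r - s)) := by
    rw [div_eq_iff hx]
    field_simp
  apply some_eq_some_of_coord_eq h₇
  · rw [hL]
    field_simp
    ring
  · rw [hL]
    field_simp
    ring

/-- **`x(8P) = x(6P) - (r - 1)(r - s)·F₁₄(r, s)/((s - 1)²(rs - 2r + 1)²)`** on `E(rs(r-1), s(r-1))`,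
for `s ≠ 1`, `r ≠ s`, `rs - 2r + 1 ≠ 0` (`8P = 7P + P`, chord slope
`r(r-1)(s-1)(r-s²+s-1)/((r-s)(rs-2r+1))`; in closed form `x(8P) = r(r-1)(r-s)(r-s²+s-1)/(rs-2r+1)²`).
This identity is the whole content of the raw model: `14P = 𝒪 ⟺ 8P = -6P ⟺ x(8P) = x(6P)`.
[cite: Sutherland2012, §2 (x₈ = x₆ for N = 14; table of xₙ, Table "F_N(r,s)" N = 14)] -/
theorem kubertTate_eight_nsmul_zero
    (h₀ : (kubertTate (r * s * (r - 1)) (s * (r - 1))).toAffine.Nonsingular 0 0)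
    (hr : r ≠ 0) (hr₁ : r ≠ 1) (hs : s ≠ 0) (hs₁ : s ≠ 1) (hrs : r ≠ s)
    (hA : r * s - 2 * r + 1 ≠ 0) :
    ∃ y h, 8 • (Affine.Point.some 0 0 h₀ : (kubertTate (r * s * (r - 1)) (s * (r - 1))).toAffine.Point)
      = Affine.Point.some (s * (r - 1) * (r - s) / (s - 1) ^ 2
          - (r - 1) * (r - s) * kubertTateRaw₁₄ r s / ((s - 1) ^ 2 * (r * s - 2 * r + 1) ^ 2)) y h := by
  obtain ⟨h₇, e₇⟩ := kubertTate_seven_nsmul_zero' r s h₀ hr hr₁ hs hs₁ hrs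
  have hs₁' : s - 1 ≠ 0 := sub_ne_zero.mpr hs₁
  have hr₁' : r - 1 ≠ 0 := sub_ne_zero.mpr hr₁
  have hrs' : r - s ≠ 0 := sub_ne_zero.mpr hrs
  simp only [kubertTateRaw₁₄]
  -- treat the `8`-torsion factor as an atom, so that `field_simp` sees `hA`
  set A := r * s - 2 * r + 1 with hAdef
  have hx : r * s * (r - 1) * (s - 1) * A / (r - s) ^ 2 ≠ 0 :=
    div_ne_zero (mul_ne_zero (mul_ne_zero (mul_ne_zero (mul_ne_zero hr hs) hr₁') hs₁') hA)
      (pow_ne_zero 2 hrs')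
  rw [show (8 : ℕ) = 7 + 1 from rfl, succ_nsmul, e₇]
  obtain ⟨h₈, e⟩ := kubertTate_some_add_some_zero (r * s * (r - 1)) (s * (r - 1)) h₇ h₀ hx
  rw [e]
  have hL : r ^ 2 * s * (r - 1) ^ 2 * (s - 1) ^ 2 * (r - s ^ 2 + s - 1) / (r - s) ^ 3
      / (r * s * (r - 1) * (s - 1) * A / (r - s) ^ 2)
      = r * (r - 1) * (s - 1) * (r - s ^ 2 + s - 1) / ((r - s) * A) := by
    rw [div_eq_iff hx]
    field_simp
  have key : ∀ {x y : F} (t : F)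
      (h : (kubertTate (r * s * (r - 1)) (s * (r - 1))).toAffine.Nonsingular x y), x = t →
      ∃ y' h', (Affine.Point.some x y h : (kubertTate (r * s * (r - 1)) (s * (r - 1))).toAffine.Point)
        = Affine.Point.some t y' h' :=
    fun t h hx => ⟨_, some_eq_some_of_coord_eq h hx rfl⟩
  refine key _ h₈ ?_
  rw [hL]
  field_simp
  rw [hAdef]
  ring

/-- **The raw model of `X₁(14)`, `(r, s)` chart**: on `E(rs(r-1), s(r-1))` with `r ∉ {0, 1}`,
`s ∉ {0, 1}`, `r ≠ s`, `rs - 2r + 1 ≠ 0` (the open part of the `(r, s)`-plane where `b ≠ 0` and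
`6P, 7P, 8P` are affine with the displayed coordinates), `14 · (0,0) = 𝒪 ⟺ F₁₄(r, s) = 0`.
Proof: `14P = 8P + 6P = 𝒪` iff `8P = -6P` iff `x(8P) = x(6P)` (the alternative `8P = 6P` would
give `2P = 𝒪`, but `2P = (b, bc)` is affine), iff the correction term
`(r-1)(r-s)F₁₄/((s-1)²(rs-2r+1)²)` of `kubertTate_eight_nsmul_zero` vanishes. [cite: Sutherland2012, §2 ("NP = 0_E ⟺ x_m = x_n", N = 14, m = 8, n = 6)] -/
theorem kubertTate_fourteen_nsmul_zero_iff
    (h₀ : (kubertTate (r * s * (r - 1)) (s * (r - 1))).toAffine.Nonsingular 0 0)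
    (hr : r ≠ 0) (hr₁ : r ≠ 1) (hs : s ≠ 0) (hs₁ : s ≠ 1) (hrs : r ≠ s)
    (hA : r * s - 2 * r + 1 ≠ 0) :
    14 • (Affine.Point.some 0 0 h₀ : (kubertTate (r * s * (r - 1)) (s * (r - 1))).toAffine.Point)
      = 0 ↔ kubertTateRaw₁₄ r s = 0 := by
  obtain ⟨h₆, e₆⟩ := kubertTate_six_nsmul_zero r s h₀ hr hr₁ hs hs₁
  obtain ⟨y₈, h₈, e₈⟩ := kubertTate_eight_nsmul_zero r s h₀ hr hr₁ hs hs₁ hrs hA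
  have hs₁' : s - 1 ≠ 0 := sub_ne_zero.mpr hs₁
  have hr₁' : r - 1 ≠ 0 := sub_ne_zero.mpr hr₁
  have hrs' : r - s ≠ 0 := sub_ne_zero.mpr hrs
  have e14 : 14 • (Affine.Point.some 0 0 h₀ :
      (kubertTate (r * s * (r - 1)) (s * (r - 1))).toAffine.Point)
      = 8 • Affine.Point.some 0 0 h₀ + 6 • Affine.Point.some 0 0 h₀ := by
    rw [show (14 : ℕ) = 8 + 6 from rfl, add_nsmul]
  constructor
  · intro h
    rw [e14] at h
    have h' := eq_neg_of_add_eq_zero_left h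
    rw [e₆, e₈, Affine.Point.neg_some, Affine.Point.some.injEq] at h'
    have hx : (r - 1) * (r - s) * kubertTateRaw₁₄ r s / ((s - 1) ^ 2 * (r * s - 2 * r + 1) ^ 2)
        = 0 := by
      linear_combination -h'.1
    rcases div_eq_zero_iff.mp hx with h0 | h0
    · rcases mul_eq_zero.mp h0 with h1 | h1
      · exact absurd h1 (mul_ne_zero hr₁' hrs')
      · exact h1
    · exact absurd h0 (mul_ne_zero (pow_ne_zero 2 hs₁') (pow_ne_zero 2 hA))
  · intro hF
    obtain ⟨h₈', e₈'⟩ := some_eq_some_of_coord_eq h₈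
      (x' := s * (r - 1) * (r - s) / (s - 1) ^ 2) (y' := y₈)
      (by rw [hF, mul_zero, zero_div, sub_zero]) rfl
    rw [e₈'] at e₈
    rcases (Affine.Point.X_eq_iff (h₁ := h₈') (h₂ := h₆)).mp rfl with h | h
    · exfalso
      -- `8P = 6P` would give `2P = 𝒪`, but `2P = (b, bc)` is affine
      have h2 : 2 • (Affine.Point.some 0 0 h₀ :
          (kubertTate (r * s * (r - 1)) (s * (r - 1))).toAffine.Point) = 0 := by
        have h86 : 8 • (Affine.Point.some 0 0 h₀ :
            (kubertTate (r * s * (r - 1)) (s * (r - 1))).toAffine.Point)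
            = 6 • Affine.Point.some 0 0 h₀ := by rw [e₈, e₆, h]
        rw [show (8 : ℕ) = 2 + 6 from rfl, add_nsmul, add_eq_right] at h86
        exact h86
      rw [kubertTate_two_nsmul_zero (r * s * (r - 1)) (s * (r - 1)) h₀] at h2
      exact Affine.Point.some_ne_zero _ h2
    · rw [e14, e₈, e₆, h, neg_add_cancel]

/-- **The raw model of `X₁(14)`, `(r, s)` chart, exact-order form**: under the same
non-degeneracy hypotheses, `(0, 0)` has order exactly `14` on `E(rs(r-1), s(r-1))` iff
`F₁₄(r, s) = 0` (`⟸`: `14P = 𝒪`, and `2P = (b, bc)`, `7P` are affine, so the order, a divisor of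
`14`, is neither `1`, `2` nor `7`). The hypotheses `r ≠ s` and `rs - 2r + 1 ≠ 0` cannot be dropped
in the `⟸` direction in characteristic `2`, where `F₁₄(r, r) = 2r(r-1)⁴` vanishes identically.
[cite: Sutherland2012, §2 (F(r,s) = 0 defining equation of X₁(N)), N = 14] -/
theorem kubertTate_addOrderOf_zero_eq_fourteen_iff_raw
    (h₀ : (kubertTate (r * s * (r - 1)) (s * (r - 1))).toAffine.Nonsingular 0 0)
    (hr : r ≠ 0) (hr₁ : r ≠ 1) (hs : s ≠ 0) (hs₁ : s ≠ 1) (hrs : r ≠ s)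
    (hA : r * s - 2 * r + 1 ≠ 0) :
    addOrderOf (Affine.Point.some 0 0 h₀ : (kubertTate (r * s * (r - 1)) (s * (r - 1))).toAffine.Point)
      = 14 ↔ kubertTateRaw₁₄ r s = 0 := by
  set P₀ : (kubertTate (r * s * (r - 1)) (s * (r - 1))).toAffine.Point :=
    Affine.Point.some 0 0 h₀ with hP₀
  constructor
  · intro h14
    have h14' : 14 • P₀ = 0 := addOrderOf_dvd_iff_nsmul_eq_zero.mp (h14 ▸ dvd_refl _)
    exact (kubertTate_fourteen_nsmul_zero_iff r s h₀ hr hr₁ hs hs₁ hrs hA).mp h14'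
  · intro hF
    have h14 : 14 • P₀ = 0 := (kubertTate_fourteen_nsmul_zero_iff r s h₀ hr hr₁ hs hs₁ hrs hA).mpr hF
    have hdvd : addOrderOf P₀ ∣ 14 := addOrderOf_dvd_of_nsmul_eq_zero h14
    have h1 : addOrderOf P₀ ≠ 1 := by
      rw [Ne, AddMonoid.addOrderOf_eq_one_iff]
      exact Affine.Point.some_ne_zero h₀
    have h2 : addOrderOf P₀ ≠ 2 := by
      intro h2
      have e : 2 • P₀ = 0 := addOrderOf_dvd_iff_nsmul_eq_zero.mp (h2 ▸ dvd_refl _)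
      rw [hP₀, kubertTate_two_nsmul_zero (r * s * (r - 1)) (s * (r - 1)) h₀] at e
      exact Affine.Point.some_ne_zero _ e
    have h7 : addOrderOf P₀ ≠ 7 := by
      intro h7
      have e : 7 • P₀ = 0 := addOrderOf_dvd_iff_nsmul_eq_zero.mp (h7 ▸ dvd_refl _)
      obtain ⟨h₇, e₇⟩ := kubertTate_seven_nsmul_zero' r s h₀ hr hr₁ hs hs₁ hrs
      rw [hP₀, e₇] at e
      exact Affine.Point.some_ne_zero _ e
    have hmem : addOrderOf P₀ ∈ Nat.divisors 14 := Nat.mem_divisors.mpr ⟨hdvd, by norm_num⟩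
    have hdivs : Nat.divisors 14 = {1, 2, 7, 14} := by decide
    rw [hdivs] at hmem
    simp only [Finset.mem_insert, Finset.mem_singleton] at hmem
    rcases hmem with h | h | h | h
    · exact absurd h h1
    · exact absurd h h2
    · exact absurd h h7
    · exact h

/-! ### From a point of order `14` on `E(b, c)` to the raw curve -/

variable {r s}
variable (b c : F)

/-- **A point of order `14` on `E(b, c)` gives a non-degenerate point of the raw curve
`F₁₄(r, s) = 0`.** Over any field `F`: if `(0, 0)` is nonsingular of order `14` on `E(b, c)`,
then `b = rs(r - 1)`, `c = s(r - 1)` with `F₁₄(r, s) = 0`, `r ∉ {0, 1}`, `s ∉ {0, 1}`, `r ≠ s`,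
`rs - 2r + 1 ≠ 0`. Order `14` makes `2P, …, 8P` nonzero and `kP ≠ ±P` for `2 ≤ k ≤ 7`, which by
equality of `x`-coordinates (`X_eq_iff`) gives in turn `c ≠ 0` (`x(3P) ≠ x(P)`), `b ≠ c`
(`x(3P) ≠ x(2P)`), then in the `(r, s)` chart `s ≠ 1` (`x(5P) ≠ 0`), `r ≠ s` (`x(6P) ≠ 0`),
`rs - 2r + 1 ≠ 0` (`x(7P) ≠ 0`), and `kubertTate_fourteen_nsmul_zero_iff` gives `F₁₄(r, s) = 0`.
[cite: Sutherland2012, §2 (any E(b,c) with P of order N > 5 yields a solution r = b/c, s = c²/(b−c) of F(r,s) = 0), N = 14] -/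
theorem exists_kubertTateRaw₁₄_eq_zero_of_addOrderOf_eq_fourteen
    (h₀ : (kubertTate b c).toAffine.Nonsingular 0 0)
    (h14 : addOrderOf (Affine.Point.some 0 0 h₀ : (kubertTate b c).toAffine.Point) = 14) :
    ∃ r s : F, b = r * s * (r - 1) ∧ c = s * (r - 1) ∧ kubertTateRaw₁₄ r s = 0 ∧
      r ≠ 0 ∧ r ≠ 1 ∧ s ≠ 0 ∧ s ≠ 1 ∧ r ≠ s ∧ r * s - 2 * r + 1 ≠ 0 := by
  have hb : b ≠ 0 := (kubertTate_nonsingular_zero_iff b c).mp h₀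
  set P₀ : (kubertTate b c).toAffine.Point := Affine.Point.some 0 0 h₀ with hP₀
  have e2 := kubertTate_two_nsmul_zero b c h₀
  have e3 := kubertTate_three_nsmul_zero b c h₀
  have hdvd : ∀ k : ℕ, k • P₀ = 0 → 14 ∣ k := fun k hk =>
    h14 ▸ addOrderOf_dvd_of_nsmul_eq_zero hk
  -- `c ≠ 0`, else `x(3P) = x(P)`
  have hc : c ≠ 0 := by
    intro hc
    rcases nsmul_eq_zero_or_of_eq_or_eq_neg P₀ 2
      (by rw [hP₀, e3]; exact (Affine.Point.X_eq_iff (h₂ := h₀)).mp hc) with h | h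
    · exact absurd (hdvd 2 h) (by norm_num)
    · exact absurd (hdvd 4 h) (by norm_num)
  -- `b ≠ c`, else `x(3P) = x(2P)`
  have hbc : b - c ≠ 0 := by
    intro hbc
    rcases (Affine.Point.X_eq_iff
      (h₁ := kubertTate_nonsingular_three b c hb)
      (h₂ := kubertTate_nonsingular_two b c hb)).mp (sub_eq_zero.mp hbc).symm with h | h
    · rw [← e2, ← e3, succ_nsmul, add_eq_left] at h
      exact Affine.Point.some_ne_zero h₀ h
    · have h5 : 5 • P₀ = 0 := by
        rw [show (5 : ℕ) = 3 + 2 from rfl, add_nsmul, hP₀, e3, e2, h, neg_add_cancel]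
      exact absurd (hdvd 5 h5) (by norm_num)
  -- pass to `(r, s)`
  obtain ⟨r, s, rfl, rfl⟩ := exists_kubertTate_param b c hc hbc
  have hs : s ≠ 0 := left_ne_zero_of_mul hc
  have hr₁' : r - 1 ≠ 0 := right_ne_zero_of_mul hc
  have hr₁ : r ≠ 1 := sub_ne_zero.mp hr₁'
  have hr : r ≠ 0 := by
    intro h
    apply hb
    rw [h]
    ring
  -- `s ≠ 1`, else `x(5P) = 0 = x(P)`
  obtain ⟨h₅, e₅⟩ := kubertTate_five_nsmul_zero r s h₀ hr hr₁ hs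
  have hs₁ : s ≠ 1 := by
    intro h1
    rcases nsmul_eq_zero_or_of_eq_or_eq_neg P₀ 4
      (by rw [hP₀, e₅]; exact (Affine.Point.X_eq_iff (h₂ := h₀)).mp (by rw [h1]; ring))
      with h | h
    · exact absurd (hdvd 4 h) (by norm_num)
    · exact absurd (hdvd 6 h) (by norm_num)
  -- `r ≠ s`, else `x(6P) = 0 = x(P)`
  obtain ⟨h₆, e₆⟩ := kubertTate_six_nsmul_zero r s h₀ hr hr₁ hs hs₁
  have hrs : r ≠ s := by
    intro h1
    rcases nsmul_eq_zero_or_of_eq_or_eq_neg P₀ 5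
      (by rw [hP₀, e₆]; exact (Affine.Point.X_eq_iff (h₂ := h₀)).mp (by rw [h1]; ring))
      with h | h
    · exact absurd (hdvd 5 h) (by norm_num)
    · exact absurd (hdvd 7 h) (by norm_num)
  -- `rs - 2r + 1 ≠ 0`, else `x(7P) = 0 = x(P)`
  obtain ⟨h₇, e₇⟩ := kubertTate_seven_nsmul_zero' r s h₀ hr hr₁ hs hs₁ hrs
  have hA : r * s - 2 * r + 1 ≠ 0 := by
    intro h1
    rcases nsmul_eq_zero_or_of_eq_or_eq_neg P₀ 6
      (by rw [hP₀, e₇]; exact (Affine.Point.X_eq_iff (h₂ := h₀)).mp (by rw [h1]; ring))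
      with h | h
    · exact absurd (hdvd 6 h) (by norm_num)
    · exact absurd (hdvd 8 h) (by norm_num)
  have h14' : 14 • P₀ = 0 := addOrderOf_dvd_iff_nsmul_eq_zero.mp (h14 ▸ dvd_refl _)
  exact ⟨r, s, rfl, rfl, (kubertTate_fourteen_nsmul_zero_iff r s h₀ hr hr₁ hs hs₁ hrs hA).mp h14',
    hr, hr₁, hs, hs₁, hrs, hA⟩

/-! ### Sutherland's optimized model `y² + (x² + x)y + x = 0`, the curve `14A4`, and the
`2`-torsion normal form `v² = u³ - 11u² + 32u` -/

variable {b c}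

omit [DecidableEq F] in
/-- **From the raw curve to Sutherland's optimized model of `X₁(14)`** (the inverse of the map
`r = 1 - (x + y)/((y + 1)(x + y + 1))`, `s = (1 - x)/(y + 1)` of Sutherland's Table of birational
maps, `N = 14`): if `F₁₄(r, s) = 0` with `r ≠ 1`, `s ≠ 1`, then
`y = (r - s)/((1 - r)(1 - s)) - 1`, `x = 1 - s(y + 1)` satisfy `y² + (x² + x)y + x = 0`
(`f₁₄(x, y) = (r - s)F₁₄(r, s)/((r - 1)³(s - 1)³)`). Any field. [cite: Sutherland2012, Table "f_N(x,y)" N = 14 and Table of birational maps N = 14] -/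
theorem sutherlandModel_of_kubertTateRaw₁₄ {r s : F} (hr₁ : r ≠ 1) (hs₁ : s ≠ 1)
    (hF : kubertTateRaw₁₄ r s = 0) :
    ((r - s) / ((1 - r) * (1 - s)) - 1) ^ 2
      + ((1 - s * ((r - s) / ((1 - r) * (1 - s)))) ^ 2 + (1 - s * ((r - s) / ((1 - r) * (1 - s)))))
        * ((r - s) / ((1 - r) * (1 - s)) - 1)
      + (1 - s * ((r - s) / ((1 - r) * (1 - s)))) = 0 := by
  have hr₁' : 1 - r ≠ 0 := sub_ne_zero.mpr (Ne.symm hr₁)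
  have hs₁' : 1 - s ≠ 0 := sub_ne_zero.mpr (Ne.symm hs₁)
  have key : ((r - s) / ((1 - r) * (1 - s)) - 1) ^ 2
      + ((1 - s * ((r - s) / ((1 - r) * (1 - s)))) ^ 2 + (1 - s * ((r - s) / ((1 - r) * (1 - s)))))
        * ((r - s) / ((1 - r) * (1 - s)) - 1)
      + (1 - s * ((r - s) / ((1 - r) * (1 - s))))
      = (r - s) * kubertTateRaw₁₄ r s / ((1 - r) ^ 3 * (1 - s) ^ 3) := by
    simp only [kubertTateRaw₁₄]
    field_simp
    ring
  rw [key, hF, mul_zero, zero_div]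

omit [DecidableEq F] in
/-- **From the raw curve to `14A4 : η² + ξη + η = ξ³ - ξ`** (Sutherland's optimized model followed
by `(ξ, η) = (-y, y(x + 1))`; in closed form `ξ = (rs - 2r + 1)/((r - 1)(s - 1))`): if
`F₁₄(r, s) = 0` with `r ≠ 1`, `s ≠ 1`, then `(ξ, η)` lies on `14A4`
(`η² + ξη + η - ξ³ + ξ = -(r - s)(rs - 2r + 1)F₁₄/((r - 1)⁴(s - 1)⁴)`). Any field.
[cite: Sutherland2012, §4 Table "genus 1 cases" N = 14 (X₁(14) ≅ y² = x³ − 675x + 13662 = 14A4); CremonaAlgorithms1997, Table 1, 14A4] -/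
theorem curve14A4_of_kubertTateRaw₁₄ {r s : F} (hr₁ : r ≠ 1) (hs₁ : s ≠ 1)
    (hF : kubertTateRaw₁₄ r s = 0) :
    let y := (r - s) / ((1 - r) * (1 - s)) - 1
    let x := 1 - s * ((r - s) / ((1 - r) * (1 - s)))
    (y * (x + 1)) ^ 2 + (-y) * (y * (x + 1)) + y * (x + 1) = (-y) ^ 3 - (-y) := by
  intro y x
  have hr₁' : 1 - r ≠ 0 := sub_ne_zero.mpr (Ne.symm hr₁)
  have hs₁' : 1 - s ≠ 0 := sub_ne_zero.mpr (Ne.symm hs₁)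
  have key : (y * (x + 1)) ^ 2 + (-y) * (y * (x + 1)) + y * (x + 1) - ((-y) ^ 3 - (-y))
      = -((r - s) * (r * s - 2 * r + 1) * kubertTateRaw₁₄ r s) / ((1 - r) ^ 4 * (1 - s) ^ 4) := by
    simp only [x, y, kubertTateRaw₁₄]
    field_simp
    ring
  rw [← sub_eq_zero, key, hF, mul_zero, neg_zero, zero_div]

omit [DecidableEq F] in
/-- **From the raw curve to the `2`-torsion normal form `V : v² = u³ - 11u² + 32u` of `14A4`**
(`u = 4ξ + 4`, `v = 8η + 4ξ + 4`; in closed form `u = 4(2rs - 3r - s + 2)/((r-1)(s-1))`,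
`v = 4(-2rs³ + 5rs² + 3r²s - s² - 6rs - 5r² + s + 7r - 2)/((r-1)²(s-1)²)`): if `F₁₄(r, s) = 0`
with `r ≠ 1`, `s ≠ 1`, then `v² = u³ - 11u² + 32u` (`X1Fourteen_polynomial_identity`). Any field.
[cite: Sutherland2012, §4 Table "genus 1 cases" N = 14] -/
theorem X1Fourteen_equation_of_kubertTateRaw₁₄ {r s : F} (hr₁ : r ≠ 1) (hs₁ : s ≠ 1)
    (hF : kubertTateRaw₁₄ r s = 0) :
    (4 * (-2 * r * s ^ 3 + 5 * r * s ^ 2 + 3 * r ^ 2 * s - s ^ 2 - 6 * r * s - 5 * r ^ 2 + s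
        + 7 * r - 2) / ((r - 1) * (s - 1)) ^ 2) ^ 2
      = (4 * (2 * r * s - 3 * r - s + 2) / ((r - 1) * (s - 1))) ^ 3
        - 11 * (4 * (2 * r * s - 3 * r - s + 2) / ((r - 1) * (s - 1))) ^ 2
        + 32 * (4 * (2 * r * s - 3 * r - s + 2) / ((r - 1) * (s - 1))) := by
  have hD : (r - 1) * (s - 1) ≠ 0 := mul_ne_zero (sub_ne_zero.mpr hr₁) (sub_ne_zero.mpr hs₁)
  have key := X1Fourteen_polynomial_identity r s
  rw [hF, mul_zero] at key
  -- atoms: `D = (r-1)(s-1)`, `U`, `Vₙ`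
  set D := (r - 1) * (s - 1) with hDdef
  set U := 4 * (2 * r * s - 3 * r - s + 2) with hUdef
  set Vn := 4 * (-2 * r * s ^ 3 + 5 * r * s ^ 2 + 3 * r ^ 2 * s - s ^ 2 - 6 * r * s - 5 * r ^ 2 + s
    + 7 * r - 2) with hVdef
  have h1 : (Vn / D ^ 2) ^ 2 = Vn ^ 2 / D ^ 4 := by
    rw [div_pow, ← pow_mul]
  have h2 : (U / D) ^ 3 - 11 * (U / D) ^ 2 + 32 * (U / D)
      = (U ^ 3 - 11 * U ^ 2 * D + 32 * U * D ^ 2) * D / D ^ 4 := by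
    rw [eq_div_iff (pow_ne_zero 4 hD)]
    field_simp
  rw [h1, h2, div_left_inj' (pow_ne_zero 4 hD)]
  linear_combination key

omit [DecidableEq F] in
/-- The abscissa `u = 4(2rs - 3r - s + 2)/((r-1)(s-1))` is not `4` when `rs - 2r + 1 ≠ 0` and
`2 ≠ 0` (`u - 4 = 4(rs - 2r + 1)/((r-1)(s-1))`). [folklore] -/
theorem X1Fourteen_u_ne_four {r s : F} (hr₁ : r ≠ 1) (hs₁ : s ≠ 1) (h2 : (2 : F) ≠ 0)
    (hA : r * s - 2 * r + 1 ≠ 0) :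
    4 * (2 * r * s - 3 * r - s + 2) / ((r - 1) * (s - 1)) ≠ 4 := by
  have hD : (r - 1) * (s - 1) ≠ 0 := mul_ne_zero (sub_ne_zero.mpr hr₁) (sub_ne_zero.mpr hs₁)
  have h4 : (4 : F) ≠ 0 := by
    rw [show (4 : F) = 2 * 2 by norm_num]; exact mul_ne_zero h2 h2
  intro h
  rw [div_eq_iff hD] at h
  apply mul_ne_zero h4 hA
  linear_combination h

omit [DecidableEq F] in
/-- The abscissa `u` is not `8` when `r ≠ s` (`u - 8 = -4(r - s)/((r-1)(s-1))`). [folklore] -/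
theorem X1Fourteen_u_ne_eight {r s : F} (hr₁ : r ≠ 1) (hs₁ : s ≠ 1) (h2 : (2 : F) ≠ 0)
    (hrs : r ≠ s) :
    4 * (2 * r * s - 3 * r - s + 2) / ((r - 1) * (s - 1)) ≠ 8 := by
  have hD : (r - 1) * (s - 1) ≠ 0 := mul_ne_zero (sub_ne_zero.mpr hr₁) (sub_ne_zero.mpr hs₁)
  have h4 : (4 : F) ≠ 0 := by
    rw [show (4 : F) = 2 * 2 by norm_num]; exact mul_ne_zero h2 h2
  intro h
  rw [div_eq_iff hD] at h
  apply mul_ne_zero h4 (sub_ne_zero.mpr hrs)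
  linear_combination -h

omit [DecidableEq F] in
/-- The abscissa `u` is not `0` on the raw curve: `u = 0` means `2rs - 3r - s + 2 = 0`, and then
`(2r - 1)⁴F₁₄ = 2(r - 1)⁶` (`two_mul_sub_one_pow_four_mul_kubertTateRaw₁₄`) forces `r = 1` in
characteristic `≠ 2`. (Geometrically: the fibre of `X₁(14) → 14A4` over the `2`-torsion cusp.)
[folklore] -/
theorem X1Fourteen_u_ne_zero {r s : F} (hr₁ : r ≠ 1) (hs₁ : s ≠ 1) (h2 : (2 : F) ≠ 0)
    (hF : kubertTateRaw₁₄ r s = 0) :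
    4 * (2 * r * s - 3 * r - s + 2) / ((r - 1) * (s - 1)) ≠ 0 := by
  have hD : (r - 1) * (s - 1) ≠ 0 := mul_ne_zero (sub_ne_zero.mpr hr₁) (sub_ne_zero.mpr hs₁)
  have h4 : (4 : F) ≠ 0 := by
    rw [show (4 : F) = 2 * 2 by norm_num]; exact mul_ne_zero h2 h2
  intro h
  rw [div_eq_zero_iff] at h
  rcases h with h | h
  · have hg : 2 * r * s - 3 * r - s + 2 = 0 := (mul_eq_zero.mp h).resolve_left h4
    have key := two_mul_sub_one_pow_four_mul_kubertTateRaw₁₄ r s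
    rw [hF, hg, mul_zero, mul_zero, add_zero] at key
    have h6 : 2 * (r - 1) ^ 6 = 0 := key.symm
    rcases mul_eq_zero.mp h6 with h0 | h0
    · exact h2 h0
    · exact hr₁ (sub_eq_zero.mp (pow_eq_zero_iff (by norm_num) |>.mp h0))
  · exact hD h

/-! ### A point of order `14` yields a point of `V : v² = u³ - 11u² + 32u` off `u ∈ {0, 4, 8}` -/

/-- **A point of order `14` on `E(b, c)` gives a point of `V` with `u ∉ {0, 4, 8}`.** Over any field
of characteristic `≠ 2`: if `(0, 0)` is nonsingular of order `14` on `E(b, c)`, there are `u v : F`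
with `v² = u³ - 11u² + 32u`, `u ≠ 0`, `u ≠ 4`, `u ≠ 8` — namely the image of `(r, s)` under the
composite of the inverse of Sutherland's birational map with `14A4 ≅ V`. [cite: Sutherland2012, §2 and §4 Table "genus 1 cases" N = 14] -/
theorem exists_X1Fourteen_point_of_kubertTate_addOrderOf_eq_fourteen (h2 : (2 : F) ≠ 0)
    (h₀ : (kubertTate b c).toAffine.Nonsingular 0 0)
    (h14 : addOrderOf (Affine.Point.some 0 0 h₀ : (kubertTate b c).toAffine.Point) = 14) :
    ∃ u v : F, v ^ 2 = u ^ 3 - 11 * u ^ 2 + 32 * u ∧ u ≠ 0 ∧ u ≠ 4 ∧ u ≠ 8 := by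
  obtain ⟨r, s, -, -, hF, -, hr₁, -, hs₁, hrs, hA⟩ :=
    exists_kubertTateRaw₁₄_eq_zero_of_addOrderOf_eq_fourteen b c h₀ h14
  exact ⟨_, _, X1Fourteen_equation_of_kubertTateRaw₁₄ hr₁ hs₁ hF,
    X1Fourteen_u_ne_zero hr₁ hs₁ h2 hF, X1Fourteen_u_ne_four hr₁ hs₁ h2 hA,
    X1Fourteen_u_ne_eight hr₁ hs₁ h2 hrs⟩

/-- **A point of order `14` on any Weierstrass curve gives a point of `V` with `u ∉ {0, 4, 8}`.**
Over any field `F` with `2 ≠ 0`: if some Weierstrass cubic over `F` has a nonsingular `F`-point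
`P` of order `14`, then `v² = u³ - 11u² + 32u` has a solution in `F` with `u ∉ {0, 4, 8}`. Proof:
`P, 2P, 3P ≠ 𝒪`, so the Tate normal form (Knapp §V.5; the tree's
`exists_variableChange_pointEquiv_eq_zero`) gives `C • W = E(b, c)` and a group isomorphism
`W(F) ≃+ E(b,c)(F)` with `P ↦ (0, 0)`, which therefore has order `14` (`AddEquiv.addOrderOf_eq`);
conclude by `exists_X1Fourteen_point_of_kubertTate_addOrderOf_eq_fourteen`. No ellipticity
hypothesis is needed. [cite: Knapp1993, §V.5 pp. 146–147; Sutherland2012, §2, §4 (N = 14)] -/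
theorem exists_X1Fourteen_point_of_addOrderOf_eq_fourteen (h2 : (2 : F) ≠ 0)
    (W : WeierstrassCurve F) {P : W.toAffine.Point} (hP : addOrderOf P = 14) :
    ∃ u v : F, v ^ 2 = u ^ 3 - 11 * u ^ 2 + 32 * u ∧ u ≠ 0 ∧ u ≠ 4 ∧ u ≠ 8 := by
  rcases P with _ | ⟨x, y, hxy⟩
  · rw [← Affine.Point.zero_def, addOrderOf_zero] at hP
    omega
  · have h2P : 2 • Affine.Point.some x y hxy ≠ 0 := fun h0 => by
      have hdvd := Nat.le_of_dvd two_pos (addOrderOf_dvd_of_nsmul_eq_zero h0)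
      rw [hP] at hdvd
      omega
    have h3P : 3 • Affine.Point.some x y hxy ≠ 0 := fun h0 => by
      have hdvd := Nat.le_of_dvd three_pos (addOrderOf_dvd_of_nsmul_eq_zero h0)
      rw [hP] at hdvd
      omega
    obtain ⟨b, c, C, hC, h₀, he⟩ := exists_variableChange_pointEquiv_eq_zero W hxy h2P h3P
    refine exists_X1Fourteen_point_of_kubertTate_addOrderOf_eq_fourteen h2 h₀ ?_
    rw [← he, AddEquiv.addOrderOf_eq, AddEquiv.addOrderOf_eq, hP]

/-- **No point of order `14` from "`V(F)` has only its points with `u ∈ {0, 4, 8}`"** (the shape of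
the theorem over `ℚ`, where the affine rational points of `V = 14A4` are `(0, 0)`, `(4, ±4)`,
`(8, ±8)`, the six rational cusps of `X₁(14)` with `𝒪`: `X1FourteenMordellWeil.lean`). If every
solution of `v² = u³ - 11u² + 32u` in a field `F` with `2 ≠ 0` has `u ∈ {0, 4, 8}`, then no
Weierstrass curve over `F` has a nonsingular `F`-point of order `14`. Contrapositive of
`exists_X1Fourteen_point_of_addOrderOf_eq_fourteen`. [cite: Kubert1976, Ch. IV (X₁(14)(ℚ) is cuspidal); Sutherland2012, §4 Table "genus 1 cases" N = 14] -/
theorem not_exists_addOrderOf_eq_fourteen_of_X1Fourteen_points (h2 : (2 : F) ≠ 0)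
    (h : ∀ u v : F, v ^ 2 = u ^ 3 - 11 * u ^ 2 + 32 * u → u = 0 ∨ u = 4 ∨ u = 8)
    (W : WeierstrassCurve F) :
    ¬ ∃ P : W.toAffine.Point, addOrderOf P = 14 := by
  rintro ⟨P, hP⟩
  obtain ⟨u, v, huv, hu0, hu4, hu8⟩ := exists_X1Fourteen_point_of_addOrderOf_eq_fourteen h2 W hP
  rcases h u v huv with h0 | h0 | h0
  · exact hu0 h0
  · exact hu4 h0
  · exact hu8 h0

end Field

end WeierstrassCurve

end
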